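/-
Copyright: the b2b-balaban cell (near-miss cell 7), T⁴-continuum CRUX team (coordinator ruling e34b3e0c item (2)),
seat t4-ne7b-formalise-leaf-06 (gen 28). Released under the licence of the surrounding project.
-/
import Summits.QuantumFields.BalabanUV.T4Continuum.Spine.NE7b.EnergyDichotomyZ4
import Summits.QuantumFields.BalabanUV.T4Continuum.Spine.NE7b.SU2QuaternionBridge
import Literature.MathematicalPhysics.QuantumFieldTheory.Balaban1983to89.T4ExpWindowSmallField
import Literature.MathematicalPhysics.QuantumLattice.SU2HaarSmallBall

/-!
# (L1) in the cell's `SU(2)` variables: the energy dichotomy for critical `SU(2)` configurations on `ℤ⁴`, small field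
# measured by `dist1 (U(∂p)) = ‖U(∂p) − 1‖`
# (route NE7b R-H, `t4/ROUTES-NE7b.md` v6.1 Δv6 item 3 ∕ v8.1 Δv8 0(c); bridge `SU2QuaternionBridge` p256776)

Cell `pub-balaban`, sub-cell `t4`, spine estimate NE7b (node U5c). `EnergyDichotomyZ4.dichotomy_unconditional` (p258045) states
(L1) for unit-quaternion configurations `ZdGaugeConfig 4 S³` with the sine-curvature `‖E_p‖ = ‖Im q_p‖` as the small-field
variable. The cell's Bałaban files speak of `SU2 = Matrix.specialUnitaryGroup (Fin 2) ℂ` configurations and measure smallness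
by `dist1 (U(∂p)) = ‖U(∂p) − 1‖` (`T4ExpWindowSmallField.dist1_eq_norm_su2Quat_sub_one`: `= ‖q_p − 1‖` in the quaternion
model). THIS FILE transports (L1) through `SU2QuaternionBridge.toSphereConfig` BY NAME and rewrites its hypotheses in that
vocabulary: since `‖Im q‖ ≤ ‖q − 1‖` (`norm_im_le_norm_sub_one`) and `‖q − 1‖ ≤ 1 ⇒ re q ≥ 0` (`re_nonneg_of_norm_sub_one_le_one`),
the hypotheses «`dist1 (U(∂p)) ≤ ½` on the hole, `dist1 (U(∂p)) ≤ b ≤ 1` off the hole» imply ALL of (L1)'s (`Re P ≥ 0` everywhere,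
`‖E‖ ≤ ½` on `I`, `‖E‖ ≤ b` off `I`). RESULT **`dichotomy_su2`** ∕ **`dichotomy_su2_dist1`**: for `U : ZdGaugeConfig 4 SU(2)`
with the four links of every hole plaquette critical (`covDiv (toSphereConfig U) = 0`, the lattice Yang–Mills equation), EITHER
`‖E_{ij}(x)‖ ≤ (1+η)·b` on the hole OR `Σ_{x∈I} max_{ij}‖E_{ij}(x)‖² ≥ η⁴∕(4(1+η)⁴·464²)`.

Records superseded (DOCFIX-1 of XREAD C-ne7bleaf05g27-5): the module docstrings of `EnergyQuantumLemma` (p256775: «`hC` … not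
proved here»), `EnergyDichotomy` (p257378) and `EnergyDichotomyZ4` (p258045: «`SU(2) ↔` unit quaternions NOT formalised») predate
`SRWKernelBoundZ4` (p257382, `hC` PROVED with `C = 4`) and `SU2QuaternionBridge` (p256776, the bridge); both caveats are void.

HONEST FRAMING. Law-free kernel facts about ONE configuration; criticality is the hypothesis `covDiv = 0` on the transported
configuration (equivalently one-link criticality of the Wilson action, `CovariantDivergenceEL.critical_iff_covDiv_eq_zero`);
nothing of (JC), (S-E), (MP<L²)'s clauses, nothing of [Bałaban 1983–89] asserted or cited. NE7b (`T4WeightBudget.RelWeightBound`)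
NOT PRINTED and NOT PROVED; spine PROVED 0∕9; rung (B)+1 on a FINITE torus T⁴ — NOT infinite volume, NOT the mass gap, NOT Clay.
HONEST DEPENDENCY: continuum YM on T⁴ ⇐ BetaPertH ∧ nine spine estimates (0/9 proved); BetaPertH ⇐ (D1) ∧ (D4) ∧ CAP+tail;
G-an2-4 gates asym, D1 and NE2/3/4. POLICY: crux-route work under `Spine/NE7b/`; 0 definitions, no `Prop`-valued fact, no
`[cite:]` fact.
-/

set_option autoImplicit false

noncomputable section

namespace Summit.QuantumFields.BalabanUV.T4Continuum.NE7b.EnergyDichotomySU2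

open Finset
open scoped BigOperators Quaternion
open Literature.MathematicalPhysics.QuantumFieldTheory (ZdGaugeConfig)
open Literature.MathematicalPhysics.QuantumLattice (su2Quat norm_su2Quat sq_norm_eq_sum_sq)
open Literature.MathematicalPhysics.QuantumFieldTheory.Balaban1983to89 (dist1)
open Literature.MathematicalPhysics.QuantumFieldTheory.Balaban1983to89.T4ExpWindowSmallField (dist1_eq_norm_su2Quat_sub_one)
open Literature.Probability.LatticeModels (Site)
open Summit.QuantumFields.BalabanUV.T4Continuum.NE7b.AbelianCurvatureMaximumPrinciple (e)
open Summit.QuantumFields.BalabanUV.T4Continuum.NE7b.CovariantDivergenceEL (curv covDiv)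
open Summit.QuantumFields.BalabanUV.T4Continuum.NE7b.EnergyDichotomy (siteCurv)
open Summit.QuantumFields.BalabanUV.T4Continuum.NE7b.EnergyDichotomyZ4 (dichotomy_unconditional)
open Summit.QuantumFields.BalabanUV.T4Continuum.NE7b.SU2QuaternionBridge (toSphereConfig coe_plaquette_toSphereConfig)

/-! ## §1 Quaternion inequalities: `‖Im q‖ ≤ ‖q − 1‖`, `|re q − 1| ≤ ‖q − 1‖` (components via `SU2HaarSmallBall.sq_norm_eq_sum_sq`) -/

/-- `‖Im q‖ ≤ ‖q − 1‖`: the imaginary part of `q − 1` is that of `q`. -/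
theorem norm_im_le_norm_sub_one (q : ℍ) : ‖q.im‖ ≤ ‖q - 1‖ := by
  have h1 : ‖q.im‖ ^ 2 ≤ ‖q - 1‖ ^ 2 := by
    rw [sq_norm_eq_sum_sq, sq_norm_eq_sum_sq]
    simp only [Quaternion.re_im, Quaternion.imI_im, Quaternion.imJ_im, Quaternion.imK_im, Quaternion.re_sub,
      Quaternion.imI_sub, Quaternion.imJ_sub, Quaternion.imK_sub, Quaternion.re_one, Quaternion.imI_one,
      Quaternion.imJ_one, Quaternion.imK_one, sub_zero]
    nlinarith [sq_nonneg (q.re - 1)]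
  exact (pow_le_pow_iff_left₀ (norm_nonneg _) (norm_nonneg _) two_ne_zero).mp h1

/-- `|re q − 1| ≤ ‖q − 1‖`, hence `‖q − 1‖ ≤ 1 ⇒ 0 ≤ re q`. -/
theorem re_nonneg_of_norm_sub_one_le_one {q : ℍ} (h : ‖q - 1‖ ≤ 1) : 0 ≤ q.re := by
  have h1 : (q.re - 1) ^ 2 ≤ ‖q - 1‖ ^ 2 := by
    rw [sq_norm_eq_sum_sq]
    simp only [Quaternion.re_sub, Quaternion.imI_sub, Quaternion.imJ_sub, Quaternion.imK_sub, Quaternion.re_one,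
      Quaternion.imI_one, Quaternion.imJ_one, Quaternion.imK_one, sub_zero]
    nlinarith [sq_nonneg q.imI, sq_nonneg q.imJ, sq_nonneg q.imK]
  have h2 : ‖q - 1‖ ^ 2 ≤ 1 := by nlinarith [norm_nonneg (q - 1)]
  nlinarith

/-! ## §2 The transported hypotheses -/

/-- The sine-curvature of the transported configuration is below the plaquette's distance to `1`:
`‖E_{ij}(x)‖ ≤ ‖q_p − 1‖`, `q_p = su2Quat (U(∂p))`. -/
theorem norm_curv_le_norm_sub_one (U : ZdGaugeConfig 4 (Matrix.specialUnitaryGroup (Fin 2) ℂ)) (x : Site 4)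
    (i j : Fin 4) : ‖curv (toSphereConfig U) x i j‖ ≤ ‖su2Quat (ZdGaugeConfig.plaquette U x i j) - 1‖ := by
  rw [curv, coe_plaquette_toSphereConfig]
  exact norm_im_le_norm_sub_one _

/-- … and `‖q_p − 1‖ = dist1 (U(∂p))` in the cell's unitary model. -/
theorem norm_curv_le_dist1 (U : ZdGaugeConfig 4 (Matrix.specialUnitaryGroup (Fin 2) ℂ)) (x : Site 4) (i j : Fin 4) :
    ‖curv (toSphereConfig U) x i j‖ ≤ dist1 (ZdGaugeConfig.plaquette U x i j) := by
  rw [dist1_eq_norm_su2Quat_sub_one]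
  exact norm_curv_le_norm_sub_one U x i j

/-! ## §3 (L1) for `SU(2)` configurations -/

/-- **(L1) FOR `SU(2)` CONFIGURATIONS ON `ℤ⁴` (quaternion-distance form).** `U : ZdGaugeConfig 4 SU(2)`, `I` a finite hole,
`0 ≤ b ≤ 1`, `η > 0`; the four links of every hole plaquette critical (`covDiv (toSphereConfig U) = 0`); `‖q_p − 1‖ ≤ ½` for
hole plaquettes and `‖q_p − 1‖ ≤ b` for every other plaquette (`q_p = su2Quat (U(∂p))`). Then EITHER `‖E_{ij}(x)‖ ≤ (1+η)·b` on
the hole OR `Σ_{x∈I} max_{ij}‖E_{ij}(x)‖² ≥ η⁴∕((1+η)⁴·4·464²)`. -/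
theorem dichotomy_su2 (U : ZdGaugeConfig 4 (Matrix.specialUnitaryGroup (Fin 2) ℂ)) (I : Finset (Site 4)) {b η : ℝ}
    (hb : 0 ≤ b) (hb1 : b ≤ 1) (hη : 0 < η)
    (hcrit : ∀ x ∈ I, ∀ i j : Fin 4, i ≠ j →
      covDiv (toSphereConfig U) x i = 0 ∧ covDiv (toSphereConfig U) (x + e j) i = 0)
    (hhole : ∀ x ∈ I, ∀ i j : Fin 4, ‖su2Quat (ZdGaugeConfig.plaquette U x i j) - 1‖ ≤ 1 / 2)
    (hout : ∀ y ∉ I, ∀ i j : Fin 4, ‖su2Quat (ZdGaugeConfig.plaquette U y i j) - 1‖ ≤ b) :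
    (∀ x ∈ I, ∀ i j : Fin 4, ‖curv (toSphereConfig U) x i j‖ ≤ (1 + η) * b)
      ∨ η ^ 4 / ((1 + η) ^ 4 * 4 * 464 ^ 2) ≤ ∑ x ∈ I, siteCurv (toSphereConfig U) x ^ 2 := by
  refine dichotomy_unconditional (toSphereConfig U) I hb hη hcrit (fun y a c => ?_) (fun x hx i j => ?_) fun y hy i j => ?_
  · -- `Re P ≥ 0` everywhere: every plaquette is within distance `1` of the identity
    rw [coe_plaquette_toSphereConfig]
    refine re_nonneg_of_norm_sub_one_le_one ?_
    by_cases hy : y ∈ I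
    · exact (hhole y hy a c).trans (by norm_num)
    · exact (hout y hy a c).trans hb1
  · exact (norm_curv_le_norm_sub_one U x i j).trans (hhole x hx i j)
  · exact (norm_curv_le_norm_sub_one U y i j).trans (hout y hy i j)

/-- **(L1) FOR `SU(2)` CONFIGURATIONS, `dist1` FORM** — the same with the cell's small-field distance
`dist1 (U(∂p)) = ‖U(∂p) − 1‖`: `dist1 ≤ ½` on the hole's plaquettes, `dist1 ≤ b ≤ 1` on all others. -/
theorem dichotomy_su2_dist1 (U : ZdGaugeConfig 4 (Matrix.specialUnitaryGroup (Fin 2) ℂ)) (I : Finset (Site 4)) {b η : ℝ}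
    (hb : 0 ≤ b) (hb1 : b ≤ 1) (hη : 0 < η)
    (hcrit : ∀ x ∈ I, ∀ i j : Fin 4, i ≠ j →
      covDiv (toSphereConfig U) x i = 0 ∧ covDiv (toSphereConfig U) (x + e j) i = 0)
    (hhole : ∀ x ∈ I, ∀ i j : Fin 4, dist1 (ZdGaugeConfig.plaquette U x i j) ≤ 1 / 2)
    (hout : ∀ y ∉ I, ∀ i j : Fin 4, dist1 (ZdGaugeConfig.plaquette U y i j) ≤ b) :
    (∀ x ∈ I, ∀ i j : Fin 4, ‖curv (toSphereConfig U) x i j‖ ≤ (1 + η) * b)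
      ∨ η ^ 4 / ((1 + η) ^ 4 * 4 * 464 ^ 2) ≤ ∑ x ∈ I, siteCurv (toSphereConfig U) x ^ 2 :=
  dichotomy_su2 U I hb hb1 hη hcrit (fun x hx i j => by rw [← dist1_eq_norm_su2Quat_sub_one]; exact hhole x hx i j)
    fun y hy i j => by rw [← dist1_eq_norm_su2Quat_sub_one]; exact hout y hy i j

end Summit.QuantumFields.BalabanUV.T4Continuum.NE7b.EnergyDichotomySU2
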